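import Summits.Ventures.PercRepro.CrossFaces

/-!
# C-005 for the three reduced networks on five vertices, at every `p`

After `ReducedPendantC005.lean` and the ≤ 8-edge theorem, the only instances of C-005 on at most
five vertices still open are `K₅ − {3,4}` (an unmarked hub of degree 3), `K₅ − {2,3}` (hub of
degree 4) and `K₅` (9, 9 and 10 edges; `mining/p4/g12/reduced_census.py`). Each is settled by
the face bridge (`FaceBridge.lean`): faces with at most eight free edges by the landed 8-point code
bound, the others because no crossing pair exists there (`CrossFaces.lean`). Hence
`C005_k5mHub3`, `C005_k5mHub4`, `C005_k5`: C-005 at every weight vector for the three graphs —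
with the reduced form of the conjecture and the census, for every network on at most five vertices.
-/

namespace PercRepro

open Finset

namespace MultiGraph

/-! ### The three graphs -/

/-- `K₅ − {3,4}`: marks `0, 1, 2, 3`, the unmarked hub `4` joined to `0, 1, 2`. Edges: `0` ab, `1`
ac, `2` ad, `3` bc, `4` bd, `5` cd, `6` 4a, `7` 4b, `8` 4c. -/
def k5mHub3 : MultiGraph (Fin 5) (Fin 9) :=
  ⟨![0, 0, 0, 1, 1, 2, 4, 4, 4], ![1, 2, 3, 2, 3, 3, 0, 1, 2]⟩

/-- Lemma B on every face of `K₅ − {3,4}`. -/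
theorem faceMap_lemmaB_k5mHub3 (u v : Config (Fin 9)) :
    crossCount cross4 (k5mHub3.faceMap ![0, 1, 2, 3] u v) ≤
      topBotCount (k5mHub3.faceMap ![0, 1, 2, 3] u v) := by
  by_cases h8 : Fintype.card (Face u v) ≤ 8
  · exact k5mHub3.faceMap_lemmaB_of_card_le_eight _ u v h8
  · have hfree := free_of_card_face_gt (u := u) (v := v) (by simp; omega)
    rw [crossCount_eq_zero_of_antipode_top]
    · exact Nat.zero_le _
    · intro ρ i hi
      exact k5mHub3.antipode_top_of_cross_free (a := 0) (b := 1) (c := 2) (d := 3)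
        (Or.inl ⟨⟨1, hfree 1, Or.inl ⟨rfl, rfl⟩⟩, ⟨3, hfree 3, Or.inr ⟨rfl, rfl⟩⟩,
          ⟨4, hfree 4, Or.inl ⟨rfl, rfl⟩⟩⟩)
        (Or.inl ⟨⟨0, hfree 0, Or.inl ⟨rfl, rfl⟩⟩, ⟨3, hfree 3, Or.inl ⟨rfl, rfl⟩⟩,
          ⟨5, hfree 5, Or.inl ⟨rfl, rfl⟩⟩⟩)
        (Or.inl ⟨⟨0, hfree 0, Or.inl ⟨rfl, rfl⟩⟩, ⟨4, hfree 4, Or.inl ⟨rfl, rfl⟩⟩,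
          ⟨5, hfree 5, Or.inr ⟨rfl, rfl⟩⟩⟩) ρ i hi

/-- **C-005 for `K₅ − {3,4}` at every `p`** (the hub `4` of degree 3 unmarked). -/
theorem C005_k5mHub3 (p : Fin 9 → ℝ) (hp : IsProb p) :
    prob p (k5mHub3.partitionEvent ![0, 1, 2, 3] ![0, 0, 1, 1]) *
        prob p (k5mHub3.partitionEvent ![0, 1, 2, 3] ![0, 1, 0, 1]) +
      prob p (k5mHub3.partitionEvent ![0, 1, 2, 3] ![0, 0, 1, 1]) *
        prob p (k5mHub3.partitionEvent ![0, 1, 2, 3] ![0, 1, 1, 0]) +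
      prob p (k5mHub3.partitionEvent ![0, 1, 2, 3] ![0, 1, 0, 1]) *
        prob p (k5mHub3.partitionEvent ![0, 1, 2, 3] ![0, 1, 1, 0]) ≤
    prob p (k5mHub3.partitionEvent ![0, 1, 2, 3] ![0, 0, 0, 0]) *
      prob p (k5mHub3.partitionEvent ![0, 1, 2, 3] ![0, 1, 2, 3]) :=
  k5mHub3.C005_of_faceMaps 0 1 2 3 (fun u v _ => faceMap_lemmaB_k5mHub3 u v) p hp

/-- `K₅ − {2,3}`: marks `0, 1, 2, 3` (the edge `2–3` absent), the unmarked hub `4` joined to all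
four. Edges: `0` ab, `1` ac, `2` ad, `3` bc, `4` bd, `5` 4a, `6` 4b, `7` 4c, `8` 4d. -/
def k5mHub4 : MultiGraph (Fin 5) (Fin 9) :=
  ⟨![0, 0, 0, 1, 1, 4, 4, 4, 4], ![1, 2, 3, 2, 3, 0, 1, 2, 3]⟩

/-- Lemma B on every face of `K₅ − {2,3}`. -/
theorem faceMap_lemmaB_k5mHub4 (u v : Config (Fin 9)) :
    crossCount cross4 (k5mHub4.faceMap ![0, 1, 2, 3] u v) ≤
      topBotCount (k5mHub4.faceMap ![0, 1, 2, 3] u v) := by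
  by_cases h8 : Fintype.card (Face u v) ≤ 8
  · exact k5mHub4.faceMap_lemmaB_of_card_le_eight _ u v h8
  · have hfree := free_of_card_face_gt (u := u) (v := v) (by simp; omega)
    rw [crossCount_eq_zero_of_antipode_top]
    · exact Nat.zero_le _
    · intro ρ i hi
      exact k5mHub4.antipode_top_of_cross_free (a := 0) (b := 1) (c := 2) (d := 3)
        (Or.inl ⟨⟨1, hfree 1, Or.inl ⟨rfl, rfl⟩⟩, ⟨3, hfree 3, Or.inr ⟨rfl, rfl⟩⟩,
          ⟨4, hfree 4, Or.inl ⟨rfl, rfl⟩⟩⟩)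
        (Or.inr (Or.inl ⟨⟨0, hfree 0, Or.inl ⟨rfl, rfl⟩⟩, ⟨3, hfree 3, Or.inl ⟨rfl, rfl⟩⟩,
          ⟨2, hfree 2, Or.inr ⟨rfl, rfl⟩⟩⟩))
        (Or.inr (Or.inl ⟨⟨0, hfree 0, Or.inl ⟨rfl, rfl⟩⟩, ⟨4, hfree 4, Or.inl ⟨rfl, rfl⟩⟩,
          ⟨1, hfree 1, Or.inr ⟨rfl, rfl⟩⟩⟩)) ρ i hi

/-- **C-005 for `K₅ − {2,3}` at every `p`** (the hub `4` of degree 4 unmarked). -/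
theorem C005_k5mHub4 (p : Fin 9 → ℝ) (hp : IsProb p) :
    prob p (k5mHub4.partitionEvent ![0, 1, 2, 3] ![0, 0, 1, 1]) *
        prob p (k5mHub4.partitionEvent ![0, 1, 2, 3] ![0, 1, 0, 1]) +
      prob p (k5mHub4.partitionEvent ![0, 1, 2, 3] ![0, 0, 1, 1]) *
        prob p (k5mHub4.partitionEvent ![0, 1, 2, 3] ![0, 1, 1, 0]) +
      prob p (k5mHub4.partitionEvent ![0, 1, 2, 3] ![0, 1, 0, 1]) *
        prob p (k5mHub4.partitionEvent ![0, 1, 2, 3] ![0, 1, 1, 0]) ≤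
    prob p (k5mHub4.partitionEvent ![0, 1, 2, 3] ![0, 0, 0, 0]) *
      prob p (k5mHub4.partitionEvent ![0, 1, 2, 3] ![0, 1, 2, 3]) :=
  k5mHub4.C005_of_faceMaps 0 1 2 3 (fun u v _ => faceMap_lemmaB_k5mHub4 u v) p hp

/-- `K₅`: marks `0, 1, 2, 3`, the unmarked hub `4` joined to all four. Edges: `0` ab, `1` ac, `2`
ad, `3` bc, `4` bd, `5` cd, `6` 4a, `7` 4b, `8` 4c, `9` 4d. -/
def k5 : MultiGraph (Fin 5) (Fin 10) :=
  ⟨![0, 0, 0, 1, 1, 2, 4, 4, 4, 4], ![1, 2, 3, 2, 3, 3, 0, 1, 2, 3]⟩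

/-- Lemma B on every face of `K₅`. -/
theorem faceMap_lemmaB_k5 (u v : Config (Fin 10)) :
    crossCount cross4 (k5.faceMap ![0, 1, 2, 3] u v) ≤
      topBotCount (k5.faceMap ![0, 1, 2, 3] u v) := by
  by_cases h8 : Fintype.card (Face u v) ≤ 8
  · exact k5.faceMap_lemmaB_of_card_le_eight _ u v h8
  · have hone := atMostOne_of_card_face_gt (u := u) (v := v) (by simp; omega)
    rw [crossCount_eq_zero_of_antipode_top]
    · exact Nat.zero_le _
    · intro ρ i hi
      exact k5.antipode_top_of_cross_free (a := 0) (b := 1) (c := 2) (d := 3)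
        (k5.threeFree_of_atMostOne u v (e₁ := 1) (e₂ := 3) (e₃ := 4) (e₄ := 2)
          (Or.inl ⟨rfl, rfl⟩) (Or.inr ⟨rfl, rfl⟩) (Or.inl ⟨rfl, rfl⟩) (Or.inr ⟨rfl, rfl⟩)
          (by decide) (by decide) (by decide) (by decide) (by decide) (by decide) hone)
        (k5.threeFree_of_atMostOne u v (e₁ := 0) (e₂ := 3) (e₃ := 5) (e₄ := 2)
          (Or.inl ⟨rfl, rfl⟩) (Or.inl ⟨rfl, rfl⟩) (Or.inl ⟨rfl, rfl⟩) (Or.inr ⟨rfl, rfl⟩)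
          (by decide) (by decide) (by decide) (by decide) (by decide) (by decide) hone)
        (k5.threeFree_of_atMostOne u v (e₁ := 0) (e₂ := 4) (e₃ := 5) (e₄ := 1)
          (Or.inl ⟨rfl, rfl⟩) (Or.inl ⟨rfl, rfl⟩) (Or.inr ⟨rfl, rfl⟩) (Or.inr ⟨rfl, rfl⟩)
          (by decide) (by decide) (by decide) (by decide) (by decide) (by decide) hone) ρ i hi

/-- **C-005 for `K₅` at every `p`** (one unmarked vertex joined to the four marks). -/
theorem C005_k5 (p : Fin 10 → ℝ) (hp : IsProb p) :
    prob p (k5.partitionEvent ![0, 1, 2, 3] ![0, 0, 1, 1]) *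
        prob p (k5.partitionEvent ![0, 1, 2, 3] ![0, 1, 0, 1]) +
      prob p (k5.partitionEvent ![0, 1, 2, 3] ![0, 0, 1, 1]) *
        prob p (k5.partitionEvent ![0, 1, 2, 3] ![0, 1, 1, 0]) +
      prob p (k5.partitionEvent ![0, 1, 2, 3] ![0, 1, 0, 1]) *
        prob p (k5.partitionEvent ![0, 1, 2, 3] ![0, 1, 1, 0]) ≤
    prob p (k5.partitionEvent ![0, 1, 2, 3] ![0, 0, 0, 0]) *
      prob p (k5.partitionEvent ![0, 1, 2, 3] ![0, 1, 2, 3]) :=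
  k5.C005_of_faceMaps 0 1 2 3 (fun u v _ => faceMap_lemmaB_k5 u v) p hp

end MultiGraph

end PercRepro
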